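import Summits.Langlands.Langlands.Theses.MirrorPairReflection
import Literature.NumberTheory.Automorphic.PairLFunctionPolesRepDataHolds
import Literature.NumberTheory.Automorphic.AutomorphicRepsGLIrreducibleL2HCHolds
import Literature.NumberTheory.Automorphic.PairLFunctionMeromorphicContinuationNeConjProofs
import Literature.NumberTheory.Automorphic.PairLFunctionPolesRepDataBoundaryRankOne
import HarnessLib

/-!
# `MirrorPairReflection.PairLBoundaryJS_of_near_gap_sh` (stmt-Langlands-18106) — the 3-way split glue, proved

[proof of `Summit.Langlands.Langlands.Theses.MirrorPairReflection.PairLBoundaryJS_of_near_gap_sh`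
(route `MirrorPairReflection`, support item, rank 804; GLUE of the registered difficulty-aligned
3-way split of `PairLBoundaryJS` (crux-strategist s2): `PairLFiniteJSNear → PairLFiniteJSGap →
PairLReciprocalSh → PairLBoundaryJS`]

The argument of the registered line `Cruxes/PairLBoundaryJS/Lines/halves.lean`
(`PairLBoundaryJS_of_halves`, kernel-checked 2026-08-17), re-threaded for THIS route's decls so that
the item closes BY NAME:
* the Jacquet–Shalika half (a finite limit `c` of `L^S(s, α × β)` as `s → s₀`, `Re s > 1`,
  `Re s₀ = 1`, off `X`) is `PairLFiniteJSNear` in the ranks `|n − m| ≤ 1` and `PairLFiniteJSGap` in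
  the ranks `|n − m| ≥ 2` (case split, `omega`);
* the Shahidi half `PairLReciprocalSh` gives a finite limit `ℓ` of `L^S(s, α × β)⁻¹`;
* Arthur–Clozel (2.1) in NON-VANISHING form for Borel–Jacquet data
  (`partialPairProduct_repData_ne_zero`, ported verbatim from the line: unitary normalisation in
  `L²_cusp` by the tree's discharged Borel–Jacquet leaves, then
  `partialPairL_ne_zero_of_isSatakeFamilyOf`) gives `L^S(s) ≠ 0` on `Re s > 1`, so along the
  PROPER filter `𝓝[Re s > 1] s₀` the products `L^S · (L^S)⁻¹ = 1` converge to `c · ℓ`, whence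
  `c · ℓ = 1` and `c ≠ 0` (`ne_zero_of_tendsto_of_tendsto_inv`; the properness of the filter is the
  adherence of `Re s = 1` to `Re s > 1`, `Complex.closure_setOf_lt_re`).
Hypothesis-free beyond the item's own binders; no Literature named fact is consumed as an axiom;
axioms `propext`, `Classical.choice`, `Quot.sound`.
[cite: ArthurClozelAMS120, Ch. 3 §2 (2.1)–(2.2), p. 171] [cite: JacquetShalikaAJM1981, Thm. (5.3)] -/

noncomputable section

set_option linter.dupNamespace false

open scoped Topology Classical
open NumberField IsDedekindDomain MeasureTheory Filter
open Literature.NumberTheory.Automorphic AdelicGroupData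

namespace Summit.Langlands.Langlands.Theorems.MirrorPairReflectionPairLBoundaryJSOfNearGapSh

open Summit.Langlands.Langlands.Theses.MirrorPairReflection

/-- **Limits of `L` and `L⁻¹` along a proper filter on which `L ≠ 0` force `lim L ≠ 0`**
(`lim L · lim L⁻¹ = lim (L · L⁻¹) = 1`). [folklore] -/
theorem ne_zero_of_tendsto_of_tendsto_inv {l : Filter ℂ} [l.NeBot] {L : ℂ → ℂ} {c ℓ : ℂ}
    (hc : Tendsto L l (𝓝 c)) (hℓ : Tendsto (fun s => (L s)⁻¹) l (𝓝 ℓ)) (hne : ∀ᶠ s in l, L s ≠ 0) :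
    c ≠ 0 := by
  have hprod : Tendsto (fun s => L s * (L s)⁻¹) l (𝓝 (c * ℓ)) := hc.mul hℓ
  have hone : Tendsto (fun s => L s * (L s)⁻¹) l (𝓝 1) :=
    tendsto_const_nhds.congr' (hne.mono fun s hs => (mul_inv_cancel₀ hs).symm)
  have hcl : c * ℓ = 1 := tendsto_nhds_unique hprod hone
  rintro rfl
  simp at hcl

/-- **Arthur–Clozel (2.1), non-vanishing form, for Borel–Jacquet data (a theorem; ported verbatim from
the registered line `Cruxes/PairLBoundaryJS/Lines/halves.lean`).** For cuspidal `π` on `GL_n(𝔸_F)`,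
`σ` on `GL_m(𝔸_F)` there is a finite `S₀` such that for every finite `S ⊇ S₀` and all unitary Satake
families `α`, `β` of `π`, `σ` off `S`, the Euler product `∏'_{v ∉ S} P_{α,β,v}(q_v^{-s})⁻¹` is non-zero
for `Re s > 1`: unitary normalisation `t_{π,w} = q_w^{s₁} t_{Π,w}`, `t_{σ,w} = q_w^{s₂} t_{Σ,w}` in
`L²_cusp` (`re s₁ = re s₂ = 0`), the factors are those of `(Π, Σ)` at `s - s₁ - s₂`
(`pairEulerFactor_eq_of_shift`), and there the product is `exp` of a convergent sum
(`partialPairL_ne_zero_of_isSatakeFamilyOf`).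
[cite: ArthurClozelAMS120, Ch. 3 §2 (2.1), p. 171] [cite: JacquetShalikaAJM1981, Thm. (5.3)] -/
theorem partialPairProduct_repData_ne_zero (n m : ℕ) (F : Type) [Field F] [NumberField F]
    (hF : isCompact_glFiniteIntegralLevel n F) (hF' : isCompact_glFiniteIntegralLevel m F)
    (hn : 0 < n) (hm : 0 < m)
    (π : CuspidalAutomorphicRepData n F hF) (π' : CuspidalAutomorphicRepData m F hF') :
    ∃ S₀ : Set (HeightOneSpectrum (𝓞 F)), S₀.Finite ∧
      ∀ {S : Set (HeightOneSpectrum (𝓞 F))}, S.Finite → S₀ ⊆ S →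
        ∀ {α β : HeightOneSpectrum (𝓞 F) → Multiset ℂ},
          (∀ w ∉ S, π.1.HasSatakeParamAt w (α w)) → (∀ w ∉ S, π'.1.HasSatakeParamAt w (β w)) →
          (∀ w ∉ S, ‖(α w).prod‖ = 1) → (∀ w ∉ S, ‖(β w).prod‖ = 1) →
          ∀ {s : ℂ}, 1 < s.re →
            (∏' v : {v : HeightOneSpectrum (𝓞 F) // v ∉ S},
              ((satakePairPolynomial (α v.1) (β v.1)).eval ((v.1.residueCard : ℂ) ^ (-s)))⁻¹) ≠ 0 := by
  haveI : NeZero n := ⟨hn.ne'⟩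
  haveI : NeZero m := ⟨hm.ne'⟩
  obtain ⟨μ, hμ⟩ := AdelicGroupData.exists_isAutomorphicMeasure_gl_holds n F
  obtain ⟨μ', hμ'⟩ := AdelicGroupData.exists_isAutomorphicMeasure_gl_holds m F
  haveI := hμ
  haveI := hμ'
  -- unitary normalisations of the two data in `L²_cusp` (Borel–Jacquet 1979, 5.7; discharged leaves)
  have hN : ∀ {k : ℕ} (hK : isCompact_glFiniteIntegralLevel k F) [NeZero k]
      (ν : Measure (gl k F).automorphicQuotient) [(gl k F).IsAutomorphicMeasure ν]
      (τ : CuspidalAutomorphicRepData k F hK),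
      ∃ (s : ℂ) (P : CuspidalAutomorphicRepGL k F ν) (S : Set (HeightOneSpectrum (𝓞 F)))
        (αP : SatakeFamily F), S.Finite ∧ IsSatakeFamilyOf P S αP ∧
        ∀ w ∉ S, ∀ β : Multiset ℂ,
          τ.1.HasSatakeParamAt w β ↔ β = (αP w).map (((w.residueCard : ℂ) ^ s) * ·) :=
    fun hK _ ν _ τ =>
      CuspidalAutomorphicRepData.exists_satake_eq_cpow_mul_L2_of_realisation
        (fun _ _ _ => AutomorphicRepsGL.exists_le_formsOfL2_of_W'_eq_bot_holds)
        (fun hK' _ ρ => CuspidalAutomorphicRepData.exists_clean_hasSatakeParamAt_of_sSup_irreducible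
          AutomorphicRepsGL.stable_cuspidal_eq_sSup_irreducible_holds ρ) hK ν τ
  obtain ⟨s₁, s₂, P, P', S₀, αP, αP', hS₀, hαP, hαP', hiff, hiff'⟩ :=
    CuspidalAutomorphicRepData.exists_pair_satake_eq_cpow_mul_of_normalisation (hN hF μ π)
      (hN hF' μ' π')
  refine ⟨S₀, hS₀, ?_⟩
  intro S hS hS₀S α β hα hβ hu hu' s hs
  have hαe := eq_map_cpow_mul_of_hasSatakeParamAt hS₀S hiff hα
  have hβe := eq_map_cpow_mul_of_hasSatakeParamAt hS₀S hiff' hβ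
  haveI := infinite_heightOneSpectrum F
  obtain ⟨w₀, hw₀⟩ := hS.infinite_compl.nonempty
  have hs₁ : s₁.re = 0 :=
    re_eq_zero_of_norm_prod_eq_one_of_shift (hαP.mono hS₀S) hn hw₀ (hαe w₀ hw₀) (hu w₀ hw₀)
  have hs₂ : s₂.re = 0 :=
    re_eq_zero_of_norm_prod_eq_one_of_shift (hαP'.mono hS₀S) hm hw₀ (hβe w₀ hw₀) (hu' w₀ hw₀)
  rw [pairEulerFactor_eq_of_shift hαe hβe s]
  have hre : 1 < (s - (s₁ + s₂)).re := by
    rwa [Complex.sub_re, Complex.add_re, hs₁, hs₂, add_zero, sub_zero]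
  simpa only [partialPairL] using
    partialPairL_ne_zero_of_isSatakeFamilyOf P P' (hαP.mono hS₀S) (hαP'.mono hS₀S) hre

/-- **stmt-Langlands-18106** `MirrorPairReflection.PairLBoundaryJS_of_near_gap_sh`: the three pieces
(JS half near the diagonal, JS half in the gap, Shahidi half in reciprocal form) give `PairLBoundaryJS`.
[cite: ArthurClozelAMS120, Ch. 3 §2 (2.2), p. 171] -/
theorem pairLBoundaryJS_of_near_gap_sh : PairLBoundaryJS_of_near_gap_sh := by
  intro hNear hGap hSh n m F _ _ hF hF' hn hm π π'
  obtain ⟨S₂, hS₂, h₂⟩ := hSh n m F hF hF' hn hm π π'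
  obtain ⟨S₃, hS₃, h₃⟩ := partialPairProduct_repData_ne_zero n m F hF hF' hn hm π π'
  by_cases hr : n = m ∨ n = m + 1 ∨ m = n + 1
  · obtain ⟨S₁, hS₁, h₁⟩ := hNear n m F hF hF' hn hm hr π π'
    refine ⟨S₁ ∪ S₂ ∪ S₃, (hS₁.union hS₂).union hS₃, ?_⟩
    intro S hS hsub α β hα hβ hu hu' s₀ hs₀ hX
    have h1S : S₁ ⊆ S := Set.subset_union_left.trans (Set.subset_union_left.trans hsub)
    have h2S : S₂ ⊆ S := Set.subset_union_right.trans (Set.subset_union_left.trans hsub)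
    have h3S : S₃ ⊆ S := Set.subset_union_right.trans hsub
    obtain ⟨c, hc⟩ := h₁ hS h1S hα hβ hu hu' hs₀ hX
    obtain ⟨ℓ, hℓ⟩ := h₂ hS h2S hα hβ hu hu' hs₀
    haveI : (𝓝[{s : ℂ | 1 < s.re}] s₀).NeBot := by
      refine mem_closure_iff_nhdsWithin_neBot.mp ?_
      rw [Complex.closure_setOf_lt_re]
      simp [hs₀]
    refine ⟨c, ne_zero_of_tendsto_of_tendsto_inv hc hℓ ?_, hc⟩
    filter_upwards [self_mem_nhdsWithin] with s hs using h₃ hS h3S hα hβ hu hu' hs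
  · obtain ⟨S₁, hS₁, h₁⟩ := hGap n m F hF hF' hn hm (by omega) π π'
    refine ⟨S₁ ∪ S₂ ∪ S₃, (hS₁.union hS₂).union hS₃, ?_⟩
    intro S hS hsub α β hα hβ hu hu' s₀ hs₀ _hX
    have h1S : S₁ ⊆ S := Set.subset_union_left.trans (Set.subset_union_left.trans hsub)
    have h2S : S₂ ⊆ S := Set.subset_union_right.trans (Set.subset_union_left.trans hsub)
    have h3S : S₃ ⊆ S := Set.subset_union_right.trans hsub
    obtain ⟨c, hc⟩ := h₁ hS h1S hα hβ hu hu' hs₀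
    obtain ⟨ℓ, hℓ⟩ := h₂ hS h2S hα hβ hu hu' hs₀
    haveI : (𝓝[{s : ℂ | 1 < s.re}] s₀).NeBot := by
      refine mem_closure_iff_nhdsWithin_neBot.mp ?_
      rw [Complex.closure_setOf_lt_re]
      simp [hs₀]
    refine ⟨c, ne_zero_of_tendsto_of_tendsto_inv hc hℓ ?_, hc⟩
    filter_upwards [self_mem_nhdsWithin] with s hs using h₃ hS h3S hα hβ hu hu' hs

end Summit.Langlands.Langlands.Theorems.MirrorPairReflectionPairLBoundaryJSOfNearGapSh

end
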